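import Summits.Ventures.HSemireg.WedgeHankelRecurrenceGaussSeparable

/-!
# Venture HSemireg — **THE EIGENVECTOR MATRIX AS A VANDERMONDE: `det (q_j(z_k))_{j,k} = ∏_{i<j} (z_j − z_i)`, hence `det(U)² = disc(q_{t+1})`**, and a second, determinant-theoretic
# route to the PRODUCT OF THE CHRISTOFFEL NUMBERS: for any weights `μ` with the dual orthogonality `U diag(μ) Uᵀ = diag(h_0, …, h_t)` (`h_j = b_1⋯b_j`, N299)
# **`(∏_k μ_k) · disc(q_{t+1}) = ∏_{j ≤ t} h_j`** (take determinants) — consistent with N410's `(∏ λ_k) disc = ∏_l b_l^{t+1−l}`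

HONEST FRAMING. Part of the Lean index of the computation cell `pub-hsemireg` (seat p10 gen 47, Sunday typer «UNIFORM-IN-n»).  Determinants of explicit matrices over a field (Mathlib
`Matrix.vandermonde`, `det_vandermonde`, `det_of_lowerTriangular`) and `Polynomial.discr` only; no variety, no cohomology theory, no sheaf, no Ext group and no semiregularity map is constructed
here; nothing here says that HC / HC_CM / HC_AV holds; no Literature fact (unproved `Prop`) is declared or used.  Custodian versions as in `WedgeHankelSiegelIdeal` (1/3).
SOURCES (cited).  G. Szegő, *Orthogonal Polynomials*, (2.2.7)–(2.2.10) (the polynomials as a unitriangular change of the monomial basis), §6.71 (`D = ∏ (x_i − x_j)²`); G. H. Golub, J. H. Welsch,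
Math. Comp. 23 (1969) §2; W. Gautschi, *Orthogonal Polynomials* (2004), §3.1.1 (the matrix `(p_j(τ_k))`); R. A. Horn, C. R. Johnson, *Matrix Analysis* (2nd ed.), §0.9.11 (Vandermonde).
PROOF TYPED HERE.  `U = Coef · Vᵀ` with `Coef_{ji} = [X^i] q_j` (lower unitriangular since `deg q_j = j`, `[X^j] q_j = 1`, N403) and `V = vandermonde z`, by `Polynomial.eval_eq_sum_range'`;
`det Coef = 1` (`Matrix.det_of_lowerTriangular`); `det Vᵀ = ∏_{i<j}(z_j − z_i)` (Mathlib); squared this is N653-block `discr_prod_X_sub_C`; finally `det(U diag μ Uᵀ) = det(U)² ∏ μ = ∏ h`.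
DEDUP DISCLOSURE (`rg -n -i 'vandermonde|det_evalMatrix' Summits/Ventures/HSemireg/WedgeHankelRecurrenceGauss*`, 2026-09-04): N299-block `det_evalMatrix_ne_zero` (nonvanishing only, from the
weights); the explicit value and the `disc` identity are new; 0 hits for the 5 names below.

WHAT IS IN THE TREE.  N403 `recurrence_natDegree_le_coeff`; N653-block `discr_prod_X_sub_C`; N299-block `evalMatrix_mul_weights_mul_transpose`; Mathlib `Matrix.vandermonde`, `Matrix.det_vandermonde`,
`Matrix.det_of_lowerTriangular`, `Polynomial.eval_eq_sum_range'`, `Matrix.det_mul`, `Matrix.det_transpose`, `Matrix.det_diagonal`.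
THIS FILE (namespace `Summit.Ventures.HSemireg.Wedge.HankelOuter` continued; CHAINED on N419 (import only); 0 definitions):
* §1185 `evalMatrix_eq_coeff_mul_vandermonde` (`U = Coef · Vᵀ`), `det_coeffMatrix_eq_one`, **`det_evalMatrix_eq_prod`** (`det U = ∏_{i<j}(z_j − z_i)`, any field, any nodes),
  **`det_evalMatrix_sq_eq_discr`** (`det(U)² = disc ∏(X − z_k)`), **`weights_prod_mul_discr_eq_prod_norms`** (`(∏ μ_k) disc q_{t+1} = ∏_j h_j`).
CAVEATS.  The first four statements need no positivity and hold over any field; the last is for the real positive recurrence with the weights of N299.  Nothing Ext-side.  New names only.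
-/

open Module Polynomial
open scoped Matrix Polynomial

namespace Summit.Ventures.HSemireg.Wedge.HankelOuter

/-! ## §1185. `det (q_j(z_k)) = Vandermonde`; `det(U)² = disc` -/

/-- **`(q_j(z_k))_{j,k} = Coef · (vandermonde z)ᵀ`** with `Coef_{ji} = [X^i] q_j` (any field, `deg q_j ≤ j ≤ t`). [Szegő (2.2.7); this file, §1185] -/
theorem evalMatrix_eq_coeff_mul_vandermonde {K : Type*} [Field K] {q : ℕ → K[X]} {a b : ℕ → K} (hq0 : q 0 = 1) (hq1 : q 1 = Polynomial.X - C (a 0))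
    (hrec : ∀ n, q (n + 2) = (Polynomial.X - C (a (n + 1))) * q (n + 1) - C (b (n + 1)) * q n) {t : ℕ} (z : Fin (t + 1) → K) :
    Matrix.of (fun j k : Fin (t + 1) => (q j).eval (z k)) = Matrix.of (fun j i : Fin (t + 1) => (q j).coeff i) * (Matrix.vandermonde z)ᵀ := by
  ext j k
  rw [Matrix.of_apply, Matrix.mul_apply, eval_eq_sum_range' (lt_of_le_of_lt (recurrence_natDegree_le_coeff hq0 hq1 hrec j).1 j.isLt) (z k),
    ← Fin.sum_univ_eq_sum_range (fun i => (q j).coeff i * z k ^ i) (t + 1)]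
  exact Finset.sum_congr rfl fun i _ => by rw [Matrix.of_apply, Matrix.transpose_apply, Matrix.vandermonde_apply]

/-- **`det Coef = 1`**: the coefficient matrix is lower unitriangular (`deg q_j ≤ j`, `[X^j] q_j = 1`). [Szegő (2.2.7); this file, §1185] -/
theorem det_coeffMatrix_eq_one {K : Type*} [Field K] {q : ℕ → K[X]} {a b : ℕ → K} (hq0 : q 0 = 1) (hq1 : q 1 = Polynomial.X - C (a 0))
    (hrec : ∀ n, q (n + 2) = (Polynomial.X - C (a (n + 1))) * q (n + 1) - C (b (n + 1)) * q n) (t : ℕ) :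
    (Matrix.of (fun j i : Fin (t + 1) => (q j).coeff i)).det = 1 := by
  rw [Matrix.det_of_lowerTriangular _ (fun j i hij => by
    rw [Matrix.of_apply]
    exact coeff_eq_zero_of_natDegree_lt (lt_of_le_of_lt (recurrence_natDegree_le_coeff hq0 hq1 hrec j).1 (by simpa using hij)))]
  exact Finset.prod_eq_one fun j _ => by rw [Matrix.of_apply]; exact (recurrence_natDegree_le_coeff hq0 hq1 hrec j).2

/-- **`det (q_j(z_k))_{j,k ≤ t} = ∏_{i<j} (z_j − z_i)`** (any field, any nodes `z`). [Szegő (2.2.7) + Vandermonde; Gautschi §3.1.1; this file, §1185] -/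
theorem det_evalMatrix_eq_prod {K : Type*} [Field K] {q : ℕ → K[X]} {a b : ℕ → K} (hq0 : q 0 = 1) (hq1 : q 1 = Polynomial.X - C (a 0))
    (hrec : ∀ n, q (n + 2) = (Polynomial.X - C (a (n + 1))) * q (n + 1) - C (b (n + 1)) * q n) {t : ℕ} (z : Fin (t + 1) → K) :
    (Matrix.of (fun j k : Fin (t + 1) => (q j).eval (z k))).det = ∏ i : Fin (t + 1), ∏ j ∈ Finset.Ioi i, (z j - z i) := by
  rw [evalMatrix_eq_coeff_mul_vandermonde hq0 hq1 hrec z, Matrix.det_mul, det_coeffMatrix_eq_one hq0 hq1 hrec t, one_mul, Matrix.det_transpose, Matrix.det_vandermonde]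

/-- **`det(U)² = disc(∏_k (X − z_k))`** for `U = (q_j(z_k))` (any field, any nodes). [Szegő §6.71; this file, §1185] -/
theorem det_evalMatrix_sq_eq_discr {K : Type*} [Field K] {q : ℕ → K[X]} {a b : ℕ → K} (hq0 : q 0 = 1) (hq1 : q 1 = Polynomial.X - C (a 0))
    (hrec : ∀ n, q (n + 2) = (Polynomial.X - C (a (n + 1))) * q (n + 1) - C (b (n + 1)) * q n) {t : ℕ} (z : Fin (t + 1) → K) :
    (Matrix.of (fun j k : Fin (t + 1) => (q j).eval (z k))).det ^ 2 = (∏ k, (Polynomial.X - C (z k))).discr := by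
  rw [det_evalMatrix_eq_prod hq0 hq1 hrec z, discr_prod_X_sub_C]

/-- **THE PRODUCT OF THE WEIGHTS BY DETERMINANTS: `U diag(μ) Uᵀ = diag(h)` ⇒ `(∏_k μ_k) · disc(q_{t+1}) = ∏_{j ≤ t} h_j`** (`h_j = b_1⋯b_j`; with the weights of N299 this is N410's
`(∏ λ_k) disc = ∏_l b_l^{t+1−l}` again). [Golub–Welsch 1969 §2 (determinant of the dual orthogonality); this file, §1185] -/
theorem weights_prod_mul_discr_eq_prod_norms {q : ℕ → ℝ[X]} {a b : ℕ → ℝ} (hq0 : q 0 = 1) (hq1 : q 1 = Polynomial.X - C (a 0))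
    (hrec : ∀ n, q (n + 2) = (Polynomial.X - C (a (n + 1))) * q (n + 1) - C (b (n + 1)) * q n) {t : ℕ} {z μ : Fin (t + 1) → ℝ}
    (hzq : q (t + 1) = ∏ k, (Polynomial.X - C (z k)))
    (hUU : Matrix.of (fun j k : Fin (t + 1) => (q j).eval (z k)) * Matrix.diagonal μ * (Matrix.of (fun j k : Fin (t + 1) => (q j).eval (z k)))ᵀ =
      Matrix.diagonal (fun j : Fin (t + 1) => ∏ l ∈ Finset.Ico 1 ((j : ℕ) + 1), b l)) :
    (∏ k, μ k) * (q (t + 1)).discr = ∏ j : Fin (t + 1), ∏ l ∈ Finset.Ico 1 ((j : ℕ) + 1), b l := by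
  have h := congrArg Matrix.det hUU
  rw [Matrix.det_mul, Matrix.det_mul, Matrix.det_transpose, Matrix.det_diagonal, Matrix.det_diagonal] at h
  rw [hzq, ← det_evalMatrix_sq_eq_discr hq0 hq1 hrec z, ← h]
  ring

/-- With POSITIVE weights from N299 (`b > 0`): the same identity with the existential weights discharged, **`∃ μ > 0`, `U diag μ Uᵀ = diag h` and `(∏ μ_k) disc(q_{t+1}) = ∏_j h_j`**.
[Golub–Welsch 1969 §2; this file, §1185] -/
theorem exists_weights_prod_mul_discr {q : ℕ → ℝ[X]} {a b : ℕ → ℝ} (hq0 : q 0 = 1) (hq1 : q 1 = Polynomial.X - C (a 0))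
    (hrec : ∀ n, q (n + 2) = (Polynomial.X - C (a (n + 1))) * q (n + 1) - C (b (n + 1)) * q n) (hb : ∀ j, 0 < b j) {t : ℕ} {z : Fin (t + 1) → ℝ}
    (hz : StrictMono z) (hzq : q (t + 1) = ∏ k, (Polynomial.X - C (z k))) :
    ∃ μ : Fin (t + 1) → ℝ, (∀ k, 0 < μ k) ∧ (∏ k, μ k) * (q (t + 1)).discr = ∏ j : Fin (t + 1), ∏ l ∈ Finset.Ico 1 ((j : ℕ) + 1), b l := by
  obtain ⟨μ, hμ, hUU⟩ := evalMatrix_mul_weights_mul_transpose hq0 hq1 hrec hb hz hzq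
  exact ⟨μ, hμ, weights_prod_mul_discr_eq_prod_norms hq0 hq1 hrec hzq hUU⟩

end Summit.Ventures.HSemireg.Wedge.HankelOuter
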